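import Summits.AtomisticToContinuum.Crystallization.Theorems.PalmUnimodularRigidityMinimiserShellsSlackCertificates

/-!
# Surcharged periodisation at the root's cell (line `octahedral-annulus-mandate`, stub 1e)
(crux `MinimiserShells`, stmt-AtomisticToContinuum-9225; registered stub `stub_surchargedReceived` of the
checked skeleton `Cruxes/MinimiserShells/Lines/octahedral_annulus_mandate.lean`, reshape r3)

Route `PalmUnimodularRigidity`, crux decl
`Summit.AtomisticToContinuum.Crystallization.Theses.PalmUnimodularRigidity.MinimiserShells`.

**Theorem** (`stub_surchargedReceived`).  Let `B` be a set of configurations, `c ≥ 0` a surcharge,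
`0 < δ₀ ≤ δ` with `-C_{δ₀} ≤ e*`, `L > 0` a mesh.  Assume the FINITE SURCHARGED INEQUALITY: for every finite
injective `δ`-separated cluster `y : Fin N → ℝ³`,
`N·e* + c·#{i : count|((· − y i) '' range y) ∉ B} ≤ 𝓔_N(y)`.
Then for every rooted `δ`-hard-core configuration `μ` the mass received at the root through the
random-grid transport of item 9229 run at the class parameter `δ₀` pays for `e* + C_{δ₀}` plus the
defect surcharge SENT, phase by phase:

`vol [0,1)³ · ofReal (e* + C_{δ₀}) + ∫_v (∑_{y ∈ C_v} c·1[(μ|C_v − y) ∉ B]) / μ(C_v) dv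
  ≤ ∫ transport δ₀ L (θ_y μ) (−y) dμ(y)`.

**Proof.**  Verbatim the IN side of 9229 (`EnergyFloor.le_lintegral_transport_map`): phase shift
(`setLIntegral_phaseDom_sub`), swap (`lintegral_count_restrict_setLIntegral_comm`), and per phase `v`, with
the cluster `T = C_v ∩ S ∋ 0` (`exists_cluster`): the mass received is
`ofReal (∑_{y ∈ T} (½∑_{z ∈ T} V(‖z − y‖) + C_{δ₀})) / #T` (`lintegral_received_eq`, from `share_map_sub_eq`),
the surcharge sent is `ofReal (#{capless indices}·c) / #T` (`sent_div_eq`, `sum_indicator_eq_ofReal`: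
`μ|C_v = count|T`, `(count|T).map (· − y) = count|((· − y) '' T)`, and the count of capless cell-mates is
the `Nat.card` of capless indices of the enumeration of `T`), and the hypothesis applied to the
enumeration of `T` (`injective_enum`, `range_enum`, `sum_half_sum_eq_interactionEnergy`) replaces the
periodisation bound `card_mul_eStar_le` of 9229 (`phase_bound`).
-/

noncomputable section

open MeasureTheory Filter Set
open scoped ENNReal BigOperators Topology

namespace Summit.AtomisticToContinuum.Crystallization.Theorems.PalmUnimodularRigidityMinimiserShells.SurchargedReceived

open Literature.Probability.Process (IsRootedHardCore count_restrict_singleton_ne_zero_iff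
  map_sub_count_restrict)
open Literature.MathematicalPhysics.StatisticalMechanics (lennardJones interactionEnergy)
open Summit.AtomisticToContinuum.Crystallization.Theorems.MinimiserShells.Negative.LoadBearing (eStar)
open Summit.AtomisticToContinuum.Crystallization.Theorems.MinimiserShells.Negative.Rootedness
  (E3 countable_of_separated)
open Summit.AtomisticToContinuum.Crystallization.Theorems.PalmUnimodularRigidityMinimiserShells.EnergyFloor

variable {δ L : ℝ} {S : Set E3}

/-! ## The mass received at a fixed phase, as a cluster sum -/

/-- **Mass received at the root at a fixed phase**, evaluated: with the cluster `T = C_v ∩ S` it is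
`ofReal (∑_{y ∈ T} (½ ∑_{z ∈ T} V(‖z - y‖) + C_δ)) / #T` (the IN computation of 9229, as an equation). -/
theorem lintegral_received_eq (hδ : 0 < δ) (hL : 0 < L) (h0 : (0 : E3) ∈ S)
    (hsep : ∀ x ∈ S, ∀ y ∈ S, x ≠ y → δ ≤ dist x y) {T : Finset E3} {v : E3}
    (hT : (↑T : Set E3) = rootCell L v ∩ S) :
    ∫⁻ y, (rootCell L (v - L⁻¹ • y)).indicator
        (fun _ => share δ (((Measure.count : Measure E3).restrict S).map fun z => z - y)
          (rootCell L (v - L⁻¹ • y))) (-y) ∂((Measure.count : Measure E3).restrict S) =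
      ENNReal.ofReal (∑ y ∈ T, ((∑ z ∈ T, lennardJones ‖z - y‖) / 2 + cst δ)) / T.card := by
  have hL0 : L ≠ 0 := hL.ne'
  -- the integrand is supported on the root's cell
  have hpt : ∀ y : E3, (rootCell L (v - L⁻¹ • y)).indicator
      (fun _ => share δ (((Measure.count : Measure E3).restrict S).map fun z => z - y)
        (rootCell L (v - L⁻¹ • y))) (-y) =
      (rootCell L v).indicator (fun y => share δ (((Measure.count : Measure E3).restrict S).map
        fun z => z - y) (rootCell L (v - L⁻¹ • y))) y := by
    intro y
    by_cases hy : y ∈ rootCell L v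
    · rw [Set.indicator_of_mem ((neg_mem_rootCell_iff hL0 v y).2 hy), Set.indicator_of_mem hy]
    · rw [Set.indicator_of_notMem (fun h => hy ((neg_mem_rootCell_iff hL0 v y).1 h)),
        Set.indicator_of_notMem hy]
  simp_rw [hpt]
  rw [lintegral_indicator (measurableSet_rootCell L v), setLIntegral_rootCell_eq_sum hT,
    Finset.sum_congr rfl fun y hy => (share_map_sub_eq hδ hL h0 hsep hT hy).2]
  -- all transported masses are non-negative
  have hnonneg : ∀ y ∈ T, 0 ≤ (∑ z ∈ T, lennardJones ‖z - y‖) / 2 + cst δ := by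
    intro y hy
    rw [← (share_map_sub_eq hδ hL h0 hsep hT hy).1]
    refine locEnergy_add_cst_nonneg hδ ?_ _
    have hyS : y ∈ rootCell L v ∩ S := by rw [← hT]; exact hy
    exact (show IsRootedHardCore δ ((Measure.count : Measure E3).restrict S)
      from ⟨S, h0, hsep, rfl⟩).map_sub ((count_restrict_singleton_ne_zero_iff S y).2 hyS.2)
  simp_rw [ENNReal.div_eq_inv_mul]
  rw [← Finset.mul_sum, ← ENNReal.ofReal_sum_of_nonneg hnonneg]

/-! ## The surcharge sent at a fixed phase, as a cluster sum -/

/-- **Surcharge sent at a fixed phase**, as a cluster sum: `μ|C_v = count|T`, re-rooting a counting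
measure translates its set, the cell sum is the sum over `T`, and `μ(C_v) = #T`. -/
theorem sent_div_eq (B : Set (Measure E3)) (c : ℝ) {T : Finset E3} {v : E3}
    (hT : (↑T : Set E3) = rootCell L v ∩ S) :
    (∫⁻ y in rootCell L v, Bᶜ.indicator (fun _ => ENNReal.ofReal c)
        ((((Measure.count : Measure E3).restrict S).restrict (rootCell L v)).map (fun z => z - y))
        ∂((Measure.count : Measure E3).restrict S)) /
        ((Measure.count : Measure E3).restrict S) (rootCell L v) =
      (∑ y ∈ T, Bᶜ.indicator (fun _ => ENNReal.ofReal c)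
        ((Measure.count : Measure E3).restrict ((fun z => z - y) '' ↑T))) / T.card := by
  have hres : ((Measure.count : Measure E3).restrict S).restrict (rootCell L v) =
      (Measure.count : Measure E3).restrict ↑T := by
    rw [Measure.restrict_restrict (measurableSet_rootCell L v), hT]
  have hmap : ∀ y : E3, (((Measure.count : Measure E3).restrict S).restrict (rootCell L v)).map
      (fun z => z - y) = (Measure.count : Measure E3).restrict ((fun z => z - y) '' ↑T) := by
    intro y
    rw [hres, map_sub_count_restrict]
  simp_rw [hmap]
  rw [setLIntegral_rootCell_eq_sum hT, count_restrict_rootCell_eq_card hT]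

/-- **Counting the capless cell-mates**: the cluster sum of the surcharge indicators is
`ofReal (#{capless indices of the enumeration of T} · c)`. -/
theorem sum_indicator_eq_ofReal (B : Set (Measure E3)) (c : ℝ) (T : Finset E3) :
    ∑ y ∈ T, Bᶜ.indicator (fun _ => ENNReal.ofReal c)
        ((Measure.count : Measure E3).restrict ((fun z => z - y) '' ↑T)) =
      ENNReal.ofReal ((Nat.card {i : Fin T.card // (Measure.count : Measure E3).restrict
        ((fun z => z - ((T.equivFin.symm i : T) : E3)) '' ↑T) ∉ B} : ℝ) * c) := by
  classical
  rw [ENNReal.ofReal_mul (Nat.cast_nonneg _), ENNReal.ofReal_natCast, Nat.card_eq_fintype_card,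
    Fintype.card_subtype, Finset.natCast_card_filter, Finset.sum_mul, ← Finset.sum_coe_sort T,
    ← Equiv.sum_comp T.equivFin.symm]
  refine Finset.sum_congr rfl fun i _ => ?_
  by_cases hB : (Measure.count : Measure E3).restrict
      ((fun z => z - ((T.equivFin.symm i : T) : E3)) '' ↑T) ∈ B
  · rw [Set.indicator_of_notMem (Set.notMem_compl_iff.2 hB), if_neg (not_not.2 hB), zero_mul]
  · rw [Set.indicator_of_mem (Set.mem_compl hB), if_pos hB, one_mul]

/-- The enumeration of a finset has the finset as its range. -/
theorem range_enum (T : Finset E3) :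
    Set.range (fun i : Fin T.card => ((T.equivFin.symm i : T) : E3)) = ↑T := by
  ext z
  constructor
  · rintro ⟨i, rfl⟩
    exact Finset.mem_coe.2 (T.equivFin.symm i).2
  · intro hz
    exact ⟨T.equivFin ⟨z, Finset.mem_coe.1 hz⟩, by simp⟩

/-- Extended non-negative real arithmetic of the per-phase bound: from `n·E + D ≤ A` (`E, D ≥ 0`,
`n ≠ 0`) to `ofReal E + ofReal D / n ≤ ofReal A / n`. -/
theorem ofReal_add_ofReal_div_le {E D A : ℝ} {n : ℕ} (hn : n ≠ 0) (hE : 0 ≤ E) (hD : 0 ≤ D)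
    (h : (n : ℝ) * E + D ≤ A) :
    ENNReal.ofReal E + ENNReal.ofReal D / n ≤ ENNReal.ofReal A / n := by
  have hn0 : (n : ℝ≥0∞) ≠ 0 := Nat.cast_ne_zero.2 hn
  have hntop : (n : ℝ≥0∞) ≠ ∞ := ENNReal.natCast_ne_top n
  rw [ENNReal.le_div_iff_mul_le (Or.inl hn0) (Or.inl hntop), add_mul,
    ENNReal.div_mul_cancel hn0 hntop, ← ENNReal.ofReal_natCast, ← ENNReal.ofReal_mul hE,
    ← ENNReal.ofReal_add (mul_nonneg hE n.cast_nonneg) hD]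
  exact ENNReal.ofReal_le_ofReal (by linarith [mul_comm (n : ℝ) E])

/-! ## The per-phase bound -/

/-- **Surcharged periodisation at a fixed phase.**  With the cluster `T = C_v ∩ S ∋ 0`, the finite
surcharged inequality applied to the enumeration of `T` (injective and `δ`-separated, since `T ⊆ S`)
reads `#T·e* + c·#{capless} ≤ ∑_{y ∈ T} ½∑_{z ∈ T} V(‖z − y‖)`, whence
`ofReal (e* + C_{δ₀}) + ofReal (#{capless}·c)/#T ≤ ofReal (∑_{y ∈ T} (½∑ V + C_{δ₀}))/#T`, the mass
received at phase `v` through the transport run at `δ₀ ≤ δ`. -/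
theorem phase_bound {B : Set (Measure E3)} {c δ₀ : ℝ} (hc : 0 ≤ c) (hδ₀ : 0 < δ₀) (hle : δ₀ ≤ δ)
    (hL : 0 < L) (hE : -cst δ₀ ≤ eStar)
    (hfin : ∀ (N : ℕ) (y : Fin N → E3), Function.Injective y →
      (∀ i j : Fin N, i ≠ j → δ ≤ dist (y i) (y j)) →
      (N : ℝ) * eStar + c * (Nat.card {i : Fin N //
          (Measure.count : Measure E3).restrict ((fun z => z - y i) '' Set.range y) ∉ B} : ℝ) ≤
        interactionEnergy lennardJones y)
    (h0 : (0 : E3) ∈ S) (hsep : ∀ x ∈ S, ∀ y ∈ S, x ≠ y → δ ≤ dist x y) (v : E3) :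
    ENNReal.ofReal (eStar + cst δ₀) +
        (∫⁻ y in rootCell L v, Bᶜ.indicator (fun _ => ENNReal.ofReal c)
          ((((Measure.count : Measure E3).restrict S).restrict (rootCell L v)).map (fun z => z - y))
          ∂((Measure.count : Measure E3).restrict S)) /
          ((Measure.count : Measure E3).restrict S) (rootCell L v) ≤
      ∫⁻ y, (rootCell L (v - L⁻¹ • y)).indicator
        (fun _ => share δ₀ (((Measure.count : Measure E3).restrict S).map fun z => z - y)
          (rootCell L (v - L⁻¹ • y))) (-y) ∂((Measure.count : Measure E3).restrict S) := by
  have hsep₀ : ∀ x ∈ S, ∀ y ∈ S, x ≠ y → δ₀ ≤ dist x y :=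
    fun x hx y hy hxy => hle.trans (hsep x hx y hy hxy)
  obtain ⟨T, hT, h0T⟩ := exists_cluster hδ₀ hL h0 hsep₀ v
  rw [lintegral_received_eq hδ₀ hL h0 hsep₀ hT, sent_div_eq B c hT, sum_indicator_eq_ofReal B c T]
  refine ofReal_add_ofReal_div_le (Finset.card_pos.2 ⟨0, h0T⟩).ne' (by linarith)
    (mul_nonneg (Nat.cast_nonneg _) hc) ?_
  -- the finite surcharged inequality on the enumerated cluster
  have hmem : ∀ i : Fin T.card, ((T.equivFin.symm i : T) : E3) ∈ rootCell L v ∩ S := fun i => by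
    rw [← hT]
    exact Finset.mem_coe.2 (T.equivFin.symm i).2
  have h := hfin T.card (fun i => ((T.equivFin.symm i : T) : E3)) (injective_enum T)
    fun i j hij => hsep _ (hmem i).2 _ (hmem j).2 fun h => hij (injective_enum T h)
  rw [range_enum T, ← sum_half_sum_eq_interactionEnergy T] at h
  rw [Finset.sum_add_distrib, Finset.sum_const, nsmul_eq_mul]
  linarith

/-! ## The registered stub -/

/-- **STUB 1e — surcharged periodisation at the root's cell.**  If the finite inequality
`N·e* + c·#{i : count|((· − y i) '' range y) ∉ B} ≤ 𝓔_N(y)` holds for all finite injective `δ`-separated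
clusters, then on every rooted `δ`-hard-core configuration the mass received through the 9229 transport run
at a class parameter `δ₀ ≤ δ` with `−C_{δ₀} ≤ e*` pays, phase by phase, for `e* + C_{δ₀}` PLUS the defect
surcharge sent: `vol·(e* + C_{δ₀}) + ∫_v (∑_{y ∈ C_v} c·1[(μ|C_v − y) ∉ B]) / #C_v dv ≤ IN`.  Route:
`EnergyFloor.le_lintegral_transport_map` (phase shift, swap) with the per-phase bound `phase_bound`. -/
theorem stub_surchargedReceived :
    ∀ B : Set (Measure E3), ∀ c δ₀ δ L : ℝ, 0 ≤ c → 0 < δ₀ → δ₀ ≤ δ → 0 < L → -cst δ₀ ≤ eStar →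
      (∀ (N : ℕ) (y : Fin N → E3), Function.Injective y → (∀ i j : Fin N, i ≠ j → δ ≤ dist (y i) (y j)) →
        (N : ℝ) * eStar + c * (Nat.card {i : Fin N //
            (Measure.count : Measure E3).restrict ((fun z => z - y i) '' Set.range y) ∉ B} : ℝ) ≤
          interactionEnergy lennardJones y) →
      ∀ μ : Measure E3, IsRootedHardCore δ μ →
        volume phaseDom * ENNReal.ofReal (eStar + cst δ₀) +
          ∫⁻ v in phaseDom, (∫⁻ y in rootCell L v, Bᶜ.indicator (fun _ => ENNReal.ofReal c)
            ((μ.restrict (rootCell L v)).map (fun z => z - y)) ∂μ) / μ (rootCell L v) ≤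
        ∫⁻ y, transport δ₀ L (μ.map fun z => z - y) (-y) ∂μ := by
  intro B c δ₀ δ L hc hδ₀ hle hL hE hfin μ hμ
  obtain ⟨S, h0, hsep, rfl⟩ := hμ
  have hS := countable_of_separated (hδ₀.trans_le hle) hsep
  -- Step 1: phase shift inside the transport
  have hshift : ∀ y : E3, ∀ ν : Measure E3,
      transport δ₀ L ν (-y) = ∫⁻ v in phaseDom, (rootCell L (v - L⁻¹ • y)).indicator
        (fun _ => share δ₀ ν (rootCell L (v - L⁻¹ • y))) (-y) := by
    intro y ν
    unfold transport
    exact (setLIntegral_phaseDom_sub (measurable_transport_integrand_phase δ₀ L ν (-y))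
      (fun k hk w => by simp only [rootCell_int_add hk]) (L⁻¹ • y)).symm
  simp_rw [hshift]
  -- Step 2: swap
  rw [lintegral_count_restrict_setLIntegral_comm hS
    (F := fun y v => (rootCell L (v - L⁻¹ • y)).indicator (fun _ => share δ₀
      (((Measure.count : Measure E3).restrict S).map fun z => z - y)
      (rootCell L (v - L⁻¹ • y))) (-y))
    (fun y => (measurable_transport_integrand_phase δ₀ L _ (-y)).comp (measurable_sub_const _))
    phaseDom]
  -- Step 3: the constant as a phase integral, and the per-phase bound
  have hconst : volume phaseDom * ENNReal.ofReal (eStar + cst δ₀) =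
      ∫⁻ _ in phaseDom, ENNReal.ofReal (eStar + cst δ₀) := by
    rw [setLIntegral_const, mul_comm]
  rw [hconst, ← lintegral_add_left measurable_const]
  exact lintegral_mono fun v => phase_bound hc hδ₀ hle hL hE hfin h0 hsep v

end Summit.AtomisticToContinuum.Crystallization.Theorems.PalmUnimodularRigidityMinimiserShells.SurchargedReceived

end
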